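import Summits.QuantumFields.YangMills.Theorems.BalabanUVNodesN16AtRecord
import Summits.QuantumFields.YangMills.Theorems.BalabanUVNodesN16Thm4Output
import HarnessLib

/-!
# Route «BalabanUVNodes», cluster K4 «SpineRates» — node N16 = NE3 «AT THE RECORD», THE SLOT RESTATED OVER [B8] THEOREM 4's OUTPUT AT THE PAIR:
# `S_N16 RRec` for every rate-record predicate pinning NE3's carriers inside THE END's regime at which N05's node holds in the form (OUT) of
# `BalabanUVNodesN16Thm4Output` (geometry-neutral: periodic gauge with the torus (1.29), left chart `e^{iηA′}` with sup∕gradient letters, the END-direction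
# residuals) and N07's interface holds — the instancer's clause for N16 without `PairLandauGaugeB8Avg`

Cell `pub-ymgap`, seat `pub-ymgap-dag-n16-a` (KNIT-BY-NAME, HUMAN RULING D-0062; chair R424 venue), generation 3, file 8.  `bears_on: R4∕N16 · K4 stub S_N16`.  Filed
`--supports stmt-QuantumFields-19182`.  Companion of file 5 `BalabanUVNodesN16AtRecord` ((W2) shape: readings, the closer `s_N16_of_pinned` over the N05 interface
`PairLandauGaugeB8Avg`, guards, face) and file 7 `BalabanUVNodesN16Thm4Output` (the N05 → N16 edge of record on N16's side, (OUT)).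

CONTENT (0 `def`, 0 `sorry`; by name): `n16At_of_pinned_thm4Output` — THE SLOT IN (OUT) FORM: there are `r > 0` and `Cof : ℝ → ℝ≥0` (functions of `(L, Nper, N)`;
file 7's `n16_of_thm4Output` + choice) such that every bundle `c : NE3Carriers N` with `c.L = L`, `c.Nper = Nper`, `0 < c.g`, `0 < c.ε ≤ r`, `0 ≤ c.Λ₁ ≤ r`,
`0 ≤ c.b ≤ c.ε∕2`, `Cof c.g ≤ c.C`, at which — for some leaf letters `(b′, c′)` on three ε-free lines (incl. `α₁ = min {1∕(3C₀(4)), c₂′(4,L)∕2}`) and some gradient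
letter `g′` on `g′ + 2(b′ + 226·320²b′²)·c.Λ₁ ≤ c.Λ₁` — (OUT) holds at the bundle's letters (sup letter `c.Λ₁`, Hölder letter `c.Λ₂'`, `β = 1`) and
`LeafH3sup 4 L Nper c.ε b′ c′ c.dom` holds, satisfies `N16At c`; **`s_N16_of_pinned_thm4Output`** — `S_N16 RRec` for every `RRec` whose bundles carry that slot.

HONEST FRAMING.  Bookkeeping by name; (OUT) = [Balaban1985RegularSpaces] Thm 4∕2 + Prop 3 OUTPUT TYPE at curved backgrounds — NOT proved anywhere in the
tree; (H3ˢᵘᵖ) = N07's [Balaban1985Variational] Thm 1 (8)+(10) TYPE; no `RRec` home exists ⇒ `S_N16` NOT proved for the record; **N16 ∕ NE3 is NOT discharged**;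
count-neutral; one finite four-torus at fixed ε — NOT ℝ⁴, NOT infinite volume, NOT OS, NOT a mass gap, NOT Clay.
-/

set_option autoImplicit false

open scoped BigOperators Matrix Matrix.Norms.L2Operator
open NormedSpace

namespace Summit.QuantumFields.YangMills.BalabanUVNodes.N16AtRecord

open Literature.MathematicalPhysics.QuantumFieldTheory.Balaban1983to89
open Literature.MathematicalPhysics.QuantumFieldTheory.Balaban1983to89.T4Continuum (T4Family ULoop)
open B7Prop1Explicit B7Prop2Explicit
open T4AveragingDeficitWall (Ad)
open B8Lemma1NonAbelian (pert)
open B7Eq92Concrete (mgauge)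
open B8Ineq132 (covDerivFwd)
open B8Eq146AExpansion (iEta)
open B8Eq184Proof (cfgExp)
open B8Eq119TwistedAxial (Restr129)
open B8Eq166ConstraintPair (ptw)
open Summit.QuantumFields.BalabanUV.T4Continuum
open MinimalActionSandwich (IsMinimiser)
open MinimalActionRate (Regular sfClass)
open BlockAverageCurrent (curConst)
open NE3EnergyShapes (IsPeriodicSite)
open NE3RightInverseSupLetters (frameC)
open NE3.PairLandauB8 (IsLandauB8 covLapDir)
open NE3.LeafIndexSockets (LeafH3sup)
open YMDAG.UVSplit (Datum NE3Carriers RateCarriers RateRecordPred N16At S_N16)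
open Summit.QuantumFields.YangMills.BalabanUVNodes.N16 (n16_of_thm4Output)

noncomputable section

variable {N : ℕ} [NeZero N]

/-- **THE SLOT IN (OUT) FORM — `N16At` AT EVERY BUNDLE PINNED IN THE END's REGIME AT WHICH THM 4's OUTPUT AND N07's INTERFACE HOLD** (block factor `L ≥ 2`,
period `Nper ≥ 1`): file 7's `n16_of_thm4Output` packaged bundle-wise (`r`, `Cof` by choice; constant raised by `NE3EnergyRateWCov.mono`). [folklore] -/
theorem n16At_of_pinned_thm4Output {L Nper : ℕ} (hL : 2 ≤ L) (hN : 1 ≤ Nper) :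
    ∃ r : ℝ, 0 < r ∧ ∃ Cof : ℝ → ℝ, (∀ g, 0 < g → 0 ≤ Cof g) ∧
      ∀ c : NE3Carriers N, c.L = L → c.Nper = Nper → 0 < c.g → 0 < c.ε → c.ε ≤ r → 0 ≤ c.Λ₁ → c.Λ₁ ≤ r → 0 ≤ c.b → c.b ≤ c.ε / 2 →
        Cof c.g ≤ c.C →
        (∃ b' c' g' : ℝ, 0 ≤ b' ∧ 0 ≤ c' ∧ 2 ^ 15 * ((4 : ℝ) + 1) ^ 2 * ((4 : ℝ) + 4) ^ 2 * (c.L : ℝ) ^ 2 * b' ≤ 1 ∧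
          23040 * (4 : ℝ) ^ 4 * (frameC 4 c.L + 4) ^ 3 * (c' + curConst 4 c.L * b' ^ 2) ≤ 1 ∧
          b' + 226 * (8 * ((4 : ℝ) + 1) * ((4 : ℝ) + 4)) ^ 2 * b' ^ 2 < min (1 / (3 * C0 4)) (c2' 4 c.L / 2) ∧
          g' + 2 * (b' + 226 * (8 * ((4 : ℝ) + 1) * ((4 : ℝ) + 4)) ^ 2 * b' ^ 2) * c.Λ₁ ≤ c.Λ₁ ∧
          (∀ k : ℕ, 1 ≤ k → ∀ V ∈ c.dom, ∀ UA UB : Site 4 → Fin 4 → (Matrix (Fin N) (Fin N) ℂ)ˣ,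
            IsMinimiser 4 (sfClass 4 c.L c.Nper c.ε) c.L c.Nper k V UA → IsMinimiser 4 (sfClass 4 c.L c.Nper c.ε) c.L c.Nper (k + 1) V UB →
            Regular 4 c.L c.Nper c.b c.g (k + 1) UB →
            ∃ u : Site 4 → (Matrix (Fin N) (Fin N) ℂ)ˣ, (∀ x, u x ∈ unitaryUnits (Matrix (Fin N) (Fin N) ℂ)) ∧ IsPeriodicSite u ((c.Nper * c.L ^ k : ℕ) : ℤ) ∧
              (∃ Λ : ℕ → Set (Site 4), Λ k = Set.univ ∧ Restr129 c.L k Λ (rescale c.L (bavg c.L UB)) u) ∧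
              ∃ A : Site 4 → Fin 4 → Matrix (Fin N) (Fin N) ℂ,
                (∀ x μ, IsSelfAdjoint (A x μ)) ∧ (∀ (x : Site 4) (κ μ : Fin 4), A (x + ((c.Nper * c.L ^ k : ℕ) : ℤ) • e κ) μ = A x μ) ∧
                mgauge (rescale c.L (bavg c.L UB)) u (cfgExp (((c.L : ℝ) ^ k)⁻¹) A)
                  = pert (gaugeAct (ptw c.L (rescale c.L (bavg c.L UB)) UA k) UA) (rescale c.L (bavg c.L UB)) ∧
                (∀ x μ, ‖A x μ‖ ≤ c.Λ₁) ∧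
                (∀ (μ : Fin 4) (x : Site 4) (κ : Fin 4), ‖covDerivFwd (((c.L : ℝ) ^ k)⁻¹) (rescale c.L (bavg c.L UB)) μ (fun z => A z κ) x‖ ≤ g') ∧
                IsLandauB8 c.L c.Nper k (rescale c.L (bavg c.L UB)) (fun x μ => Ad (rescale c.L (bavg c.L UB) x μ)⁻¹ (iEta (((c.L : ℝ) ^ k)⁻¹) A x μ)) ∧
                (∀ (κ μ : Fin 4) (y : Site 4),
                  ‖Ad (rescale c.L (bavg c.L UB) (y + e κ) μ)
                      (Ad (rescale c.L (bavg c.L UB) (y + e κ + e μ) μ)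
                          ((fun x μ => Ad (rescale c.L (bavg c.L UB) x μ)⁻¹ (iEta (((c.L : ℝ) ^ k)⁻¹) A x μ)) (y + (2 : ℕ) • e μ) κ)
                        - (fun x μ => Ad (rescale c.L (bavg c.L UB) x μ)⁻¹ (iEta (((c.L : ℝ) ^ k)⁻¹) A x μ)) (y + e μ) κ)
                    - (Ad (rescale c.L (bavg c.L UB) (y + e κ) μ)
                        ((fun x μ => Ad (rescale c.L (bavg c.L UB) x μ)⁻¹ (iEta (((c.L : ℝ) ^ k)⁻¹) A x μ)) (y + e μ) κ)
                      - (fun x μ => Ad (rescale c.L (bavg c.L UB) x μ)⁻¹ (iEta (((c.L : ℝ) ^ k)⁻¹) A x μ)) y κ)‖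
                    ≤ c.Λ₂' * (((c.L : ℝ)⁻¹) ^ k) ^ ((2 : ℝ) + 1)) ∧
                (∀ (x : Site 4) (κ : Fin 4),
                  ‖covLapDir (rescale c.L (bavg c.L UB)) (fun x μ => Ad (rescale c.L (bavg c.L UB) x μ)⁻¹ (iEta (((c.L : ℝ) ^ k)⁻¹) A x μ)) x κ‖
                    ≤ c.Λ₁ * (((c.L : ℝ)⁻¹) ^ k) ^ 3)) ∧
          LeafH3sup 4 c.L c.Nper c.ε b' c' c.dom) →
        N16At c := by
  obtain ⟨r, hr0, hr⟩ := n16_of_thm4Output (n := Fin N) hL hN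
  choose Cof hCof0 hCof using hr
  refine ⟨r, hr0, fun g => if h : 0 < g then Cof h else 0, fun g hg => by simp only [dif_pos hg]; exact hCof0 hg, ?_⟩
  rintro ⟨cL, cN, ε, b, g, C, Λ₁, Λ₂', dom⟩ rfl rfl hg hε hεr hs₁ hs₁r hb hbh hC ⟨b', c', g', hb', hc', hRb, hcF, hb'α, hgrad, hOut, h3⟩
  simp only [dif_pos hg] at hC
  exact (hCof hg hb' hc' hRb hcF hb'α hε hεr hs₁ hs₁r hb hbh hgrad Λ₂' hOut h3).mono hC le_rfl le_rfl

/-- **REFINEMENT-GENERIC CLOSER IN (OUT) FORM — `S_N16 RRec` FOR EVERY RATE-RECORD PREDICATE CARRYING THE SLOT**: if `RRec F D g₀ os R` forces `R.ne3` into THE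
END's regime (radius `r`, constant `≥ Cof R.ne3.g` of `n16At_of_pinned_thm4Output`) and, at its letters, [Balaban1985RegularSpaces] Thm 4's OUTPUT at every
minimiser pair (the (OUT) clause, with some leaf∕gradient letters on their ε-free lines) and N07's `LeafH3sup`, then `S_N16 RRec` — the instancer's clause for N16
with NO `PairLandauGaugeB8Avg` and NO `Thm4At`.  Nothing is asserted about the record's `RRec` (none exists). [folklore] -/
theorem s_N16_of_pinned_thm4Output {L Nper : ℕ} (hL : 2 ≤ L) (hN : 1 ≤ Nper) :
    ∃ r : ℝ, 0 < r ∧ ∃ Cof : ℝ → ℝ, (∀ g, 0 < g → 0 ≤ Cof g) ∧ ∀ RRec : RateRecordPred N,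
      (∀ (F : T4Family) (D : Datum F N) (g₀ : ℕ → ℝ) (os : List (ULoop F)) (R : RateCarriers N), RRec F D g₀ os R →
        R.ne3.L = L ∧ R.ne3.Nper = Nper ∧ 0 < R.ne3.g ∧ 0 < R.ne3.ε ∧ R.ne3.ε ≤ r ∧ 0 ≤ R.ne3.Λ₁ ∧ R.ne3.Λ₁ ≤ r ∧ 0 ≤ R.ne3.b ∧
        R.ne3.b ≤ R.ne3.ε / 2 ∧ Cof R.ne3.g ≤ R.ne3.C ∧
        (∃ b' c' g' : ℝ, 0 ≤ b' ∧ 0 ≤ c' ∧ 2 ^ 15 * ((4 : ℝ) + 1) ^ 2 * ((4 : ℝ) + 4) ^ 2 * (R.ne3.L : ℝ) ^ 2 * b' ≤ 1 ∧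
          23040 * (4 : ℝ) ^ 4 * (frameC 4 R.ne3.L + 4) ^ 3 * (c' + curConst 4 R.ne3.L * b' ^ 2) ≤ 1 ∧
          b' + 226 * (8 * ((4 : ℝ) + 1) * ((4 : ℝ) + 4)) ^ 2 * b' ^ 2 < min (1 / (3 * C0 4)) (c2' 4 R.ne3.L / 2) ∧
          g' + 2 * (b' + 226 * (8 * ((4 : ℝ) + 1) * ((4 : ℝ) + 4)) ^ 2 * b' ^ 2) * R.ne3.Λ₁ ≤ R.ne3.Λ₁ ∧
          (∀ k : ℕ, 1 ≤ k → ∀ V ∈ R.ne3.dom, ∀ UA UB : Site 4 → Fin 4 → (Matrix (Fin N) (Fin N) ℂ)ˣ,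
            IsMinimiser 4 (sfClass 4 R.ne3.L R.ne3.Nper R.ne3.ε) R.ne3.L R.ne3.Nper k V UA → IsMinimiser 4 (sfClass 4 R.ne3.L R.ne3.Nper R.ne3.ε) R.ne3.L R.ne3.Nper (k + 1) V UB →
            Regular 4 R.ne3.L R.ne3.Nper R.ne3.b R.ne3.g (k + 1) UB →
            ∃ u : Site 4 → (Matrix (Fin N) (Fin N) ℂ)ˣ, (∀ x, u x ∈ unitaryUnits (Matrix (Fin N) (Fin N) ℂ)) ∧ IsPeriodicSite u ((R.ne3.Nper * R.ne3.L ^ k : ℕ) : ℤ) ∧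
              (∃ Λ : ℕ → Set (Site 4), Λ k = Set.univ ∧ Restr129 R.ne3.L k Λ (rescale R.ne3.L (bavg R.ne3.L UB)) u) ∧
              ∃ A : Site 4 → Fin 4 → Matrix (Fin N) (Fin N) ℂ,
                (∀ x μ, IsSelfAdjoint (A x μ)) ∧ (∀ (x : Site 4) (κ μ : Fin 4), A (x + ((R.ne3.Nper * R.ne3.L ^ k : ℕ) : ℤ) • e κ) μ = A x μ) ∧
                mgauge (rescale R.ne3.L (bavg R.ne3.L UB)) u (cfgExp (((R.ne3.L : ℝ) ^ k)⁻¹) A)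
                  = pert (gaugeAct (ptw R.ne3.L (rescale R.ne3.L (bavg R.ne3.L UB)) UA k) UA) (rescale R.ne3.L (bavg R.ne3.L UB)) ∧
                (∀ x μ, ‖A x μ‖ ≤ R.ne3.Λ₁) ∧
                (∀ (μ : Fin 4) (x : Site 4) (κ : Fin 4), ‖covDerivFwd (((R.ne3.L : ℝ) ^ k)⁻¹) (rescale R.ne3.L (bavg R.ne3.L UB)) μ (fun z => A z κ) x‖ ≤ g') ∧
                IsLandauB8 R.ne3.L R.ne3.Nper k (rescale R.ne3.L (bavg R.ne3.L UB)) (fun x μ => Ad (rescale R.ne3.L (bavg R.ne3.L UB) x μ)⁻¹ (iEta (((R.ne3.L : ℝ) ^ k)⁻¹) A x μ)) ∧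
                (∀ (κ μ : Fin 4) (y : Site 4),
                  ‖Ad (rescale R.ne3.L (bavg R.ne3.L UB) (y + e κ) μ)
                      (Ad (rescale R.ne3.L (bavg R.ne3.L UB) (y + e κ + e μ) μ)
                          ((fun x μ => Ad (rescale R.ne3.L (bavg R.ne3.L UB) x μ)⁻¹ (iEta (((R.ne3.L : ℝ) ^ k)⁻¹) A x μ)) (y + (2 : ℕ) • e μ) κ)
                        - (fun x μ => Ad (rescale R.ne3.L (bavg R.ne3.L UB) x μ)⁻¹ (iEta (((R.ne3.L : ℝ) ^ k)⁻¹) A x μ)) (y + e μ) κ)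
                    - (Ad (rescale R.ne3.L (bavg R.ne3.L UB) (y + e κ) μ)
                        ((fun x μ => Ad (rescale R.ne3.L (bavg R.ne3.L UB) x μ)⁻¹ (iEta (((R.ne3.L : ℝ) ^ k)⁻¹) A x μ)) (y + e μ) κ)
                      - (fun x μ => Ad (rescale R.ne3.L (bavg R.ne3.L UB) x μ)⁻¹ (iEta (((R.ne3.L : ℝ) ^ k)⁻¹) A x μ)) y κ)‖
                    ≤ R.ne3.Λ₂' * (((R.ne3.L : ℝ)⁻¹) ^ k) ^ ((2 : ℝ) + 1)) ∧
                (∀ (x : Site 4) (κ : Fin 4),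
                  ‖covLapDir (rescale R.ne3.L (bavg R.ne3.L UB)) (fun x μ => Ad (rescale R.ne3.L (bavg R.ne3.L UB) x μ)⁻¹ (iEta (((R.ne3.L : ℝ) ^ k)⁻¹) A x μ)) x κ‖
                    ≤ R.ne3.Λ₁ * (((R.ne3.L : ℝ)⁻¹) ^ k) ^ 3)) ∧
          LeafH3sup 4 R.ne3.L R.ne3.Nper R.ne3.ε b' c' R.ne3.dom)) →
      S_N16 RRec := by
  obtain ⟨r, hr0, Cof, hCof0, hAt⟩ := n16At_of_pinned_thm4Output (N := N) hL hN
  refine ⟨r, hr0, Cof, hCof0, fun RRec hpin F D g₀ os R hR => ?_⟩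
  obtain ⟨h1, h2, h3, h4, h5, h6, h7, h8, h9, h10, hslot⟩ := hpin F D g₀ os R hR
  exact hAt R.ne3 h1 h2 h3 h4 h5 h6 h7 h8 h9 h10 hslot

end

end Summit.QuantumFields.YangMills.BalabanUVNodes.N16AtRecord
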